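import Summits.QuantumFields.YangMills.Theorems.UnitScaleTiltProp7CovBlockGauss
import Summits.QuantumFields.YangMills.Theorems.UnitScaleTiltProp7AxialLocalModel
import Summits.QuantumFields.YangMills.Theorems.UnitScaleTiltProp7AxialGaugeBlock
import Summits.QuantumFields.YangMills.Theorems.UnitScaleTiltProp7TracePairing
import HarnessLib

/-!
# Route `UnitScaleTilt`, crux K1 «MinimiserStabilityRegPr» (stmt-QuantumFields-19200), route-R E′ S3 K-form engine, row (P′) ∕ hXb — «INT-PAIRING»:
# with the comb of record (centre-based axial transports `T_r = v₀(x_r) = axialT V c_y x_r`) the interior holonomy defect `INT_μ(y)` of the block Gauss law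
# ✓ `Prop7CovBlockGauss.block_sum_R_divB_eq` is, bond by bond, `(R(V(Γ_{c,x} ∪ ⟨x,μ⟩ ∪ Γ_{x+e_μ,c}))⁻¹ − 1)` on the transported `B` — the loop of [Balaban1985UV3] (27) — and its
# pairing with the centre value `m = φ₀(c_y)` IS the pairing of `B` with the covariant derivative of the AXIAL LOCAL MODEL `Ψ_m = R(v₀⁻¹)m` (✓ `Prop7AxialLocalModel.covD_axialModel`):
# `Re tr(mᴴ·INT_μ(y)) = Σ_{(x, x+e_μ) ⊂ B(y)} Re tr((D_{V,μ}Ψ_m)(x)ᴴ·B_μ(x))` — exact, so the interior part of hXb is booked by the DIRICHLET energy of the local models (hDir's currency)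

Cell `ym3-torus`, width seat `ym3-torus-px15` (gen 3); continues «BLOCK-GAUSS» (★ym-ust-19200-p1 g16 WORD 10 (2)) towards the inhabitant of px5's displayed Gauss row `hXb` (✓ `Prop7RowPOfFaceFluxRows`).
THEOREMS ONLY (0 `def`, 0 `sorry`, 0 `instance`); `--supports stmt-QuantumFields-19200`, count-neutral.  YM₃ on T³ is a ladder rung (R3), not the Clay problem; nothing here claims a stub,
the crux, d = 4 or the mass gap.

THE POINT (px17 LOCATE-R3PRIME-COVFACEFLUX §3 (G4), in kernel letters).  In ✓ `block_sum_R_divB_eq` the interior term of the bond `b = (x_r, x_r + e_μ)` is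
`R(T_r)(R(T_r⁻¹·T_{r+e_μ}·V(b)⁻¹)B(b) − B(b))`.  For `T_r := axialT V c x_r` (the comb from the block CENTRE `c = embIter k y`; no wrap-around inside a block, ✓ `Prop7AxialGaugeBlock.noWrap_centre`)
`T_r·V(b)·T_{r+e_μ}⁻¹ = V(Γ_{c,x_r} ∪ b ∪ Γ_{x_r+e_μ,c}) =: L_b` (✓ `B10Eq27TorusAxialLog.holT_contourT`), so the term is `R(L_b⁻¹)(R(T_r)B(b)) − R(T_r)B(b)`; pairing with `m` and moving the
unitary `L_b`, `T_r` across the trace gives `⟨R(L_b)m − m, R(T_r)B(b)⟩ = ⟨R(T_r)(D_{V,μ}Ψ_m)(x_r), R(T_r)B(b)⟩ = ⟨(D_{V,μ}Ψ_m)(x_r), B(b)⟩` by ✓ `covD_axialModel`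
(`D_VΨ_m(x,μ) = R(v₀(x)⁻¹)(R(L_{⟨x,μ⟩})m − m)`).  Hence Σ₁ of px17's LOCATE is Cauchy–Schwarz between `M(B)` and the Dirichlet energy of the axial local models on the blocks' interior bonds —
the currency of ★p1 g16's displayed row hDir ∕ hKg′-K(fam) (✓p680787 `dirichlet_offsetFamily_le_transported`), not a new analytic row.

WHAT IS PROVED (ns `…Theorems.Prop7CovBlockGaussIntPairing`).
* §1 (any group-valued `V`, any ring): `fibreSite_succ_eq_shift` (the `r_μ ↦ r_μ+1` offset of ✓ `block_sum_R_divB_eq` IS `x_r + e_μ`), `noWrap_fibreSite`, ★ `comb_loop_eq`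
  (`T_r⁻¹·T_{r+e_μ}·V(b)⁻¹ = T_r⁻¹·L_b⁻¹·T_r`), ★★ `int_summand_eq_loop` (`= R(L_b⁻¹)(R(T_r)B) − R(T_r)B`).
* §2 (`M_N(ℂ)`, unitary-valued `V`): `re_trace_mul_R_inv_sub` (`Re tr(mᴴ(R(u⁻¹)X − X)) = Re tr((R(u)m − m)ᴴX)`), `re_trace_R_pair` (`Re tr((R(t)A)ᴴ R(t)B) = Re tr(AᴴB)`),
  ★★★ `re_trace_int_summand_eq_covD_pairing` (one bond), ★★★ `re_trace_int_eq_sum_covD_pairing` (the block: `Re tr(mᴴ·INT(y)) = Σ_μ Σ_{r_μ+1<L^k} Re tr((D_μΨ_m(x_r))ᴴ B_μ(x_r))`),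
  ★★★ `re_trace_netFlux_eq` (with ✓ `block_netFlux_eq_int_add_junction`: `Re tr(mᴴ·NETFLUX(y)) = Σ ⟨D Ψ_m, B⟩_{int B(y)} + Re tr(mᴴ·J_VH(y))` for co-closed `B`).
HONEST SCOPE.  Exact algebra over landed theorems (block Gauss law, the (27) loop, the axial local model, trace cyclicity); no estimate, no smallness.  The Cauchy–Schwarz∕multiplicity step
(interior bonds of `B(y)` ⊂ routeR-w1's `N(y)` family), the `J_VH` bound and the face piece (G2) ✓p670095 are the remaining (bookkeeping) bricks of hXb's inhabitant.

References: T. Bałaban, CMP 102 (1985) 255–275 [Balaban1985UV3] ((27) p.263); CMP 98 (1985) 17–51 [Balaban1985Averaging] ((8)–(9) pp.18–19, p.24); CMP 99 (1985) 389–434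
[Balaban1985BackgroundPropagators] ((3.3)–(3.5) pp.390–391, (3.8) p.392); CMP 95 (1984) 17–40 [Balaban1984PropagatorsI] ((1.21) p.21); CMP 102 (1985) 277–309 [Balaban1985Variational] (Prop. 7 p.299).
-/

set_option autoImplicit false

noncomputable section

open scoped BigOperators Matrix

namespace Summit.QuantumFields.YangMills.Theorems.Prop7CovBlockGaussIntPairing

open Literature.MathematicalPhysics.QuantumFieldTheory.Balaban1983to89
open Finset
open B9Eq39Adjoint (R R_one R_mul_R R_inv_R R_R_inv covD divB)
open B9TorusCalculus (torusT torusT_apply)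
open B10Eq27TorusAxialLog (holT axialT contourT rel holT_contourT hol_pull_zero)
open B15DeterminingSets (embIter)
open B5Eq118OneStroke (iterBlockOf)
open B7Prop2Explicit (unitaryUnits mem_unitaryUnits hol_mem_of)
open Summit.QuantumFields.YangMills.Theorems.Prop7CovBlockGauss (block_sum_R_divB_eq block_netFlux_eq_int_add_junction)
open Summit.QuantumFields.YangMills.Theorems.Prop7LineAvgSmoothRightInverse (fibreSite_shift_of_lt)
open Summit.QuantumFields.YangMills.Theorems.Prop7AxialLocalModel (covD_axialModel)
open Summit.QuantumFields.YangMills.Theorems.Prop7AxialGaugeBlock (noWrap_centre)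
open Summit.QuantumFields.YangMills.Theorems.Prop7CombGauge (iterBlockOf_fibreSite)
open Summit.QuantumFields.YangMills.Theorems.Prop7CovariantCoercivity (coe_inv_eq_star conjTranspose_R)

variable {P : Params} {k : ℕ}

/-! ## §1 The interior summand of the block Gauss law IS the loop of (27), for the centre-based comb -/

section Loop

variable {G : Type*} [Group G]

/-- The `r_μ ↦ r_μ + 1` offset of ✓ `block_sum_R_divB_eq` (written totally with `min`) is the site `x_r + e_μ` on the interior filter `r_μ + 1 < L^k`.
[cite: Balaban1987RG1, (0.3) p.252] -/
theorem fibreSite_succ_eq_shift (y : Site P k) (r : Fin P.d → Fin (P.L ^ k)) (μ : Fin P.d) (hr : (r μ : ℕ) + 1 < P.L ^ k) :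
    Site.fibreSite 0 k y (Function.update r μ ⟨min ((r μ : ℕ) + 1) (P.L ^ k - 1), by have := (r μ).isLt; omega⟩)
      = (Site.fibreSite 0 k y r).shift μ := by
  rw [fibreSite_shift_of_lt y r μ hr]
  congr 2
  apply Fin.ext
  show min ((r μ : ℕ) + 1) (P.L ^ k - 1) = (r μ : ℕ) + 1
  omega

/-- No wrap-around from the block centre: `2·((x_r − c_y)_μ + 1) ≤ N₀` (✓ `noWrap_centre` at `x_r`, whose `k`-block point is `y`). [cite: Balaban1987RG1, (0.1) p.252] -/
theorem noWrap_fibreSite (hk : k ≤ P.m + P.K) (h : P.sitesPerDir 0 = P.L ^ k * P.sitesPerDir k) (y : Site P k) (r : Fin P.d → Fin (P.L ^ k)) (μ : Fin P.d) :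
    (rel (embIter k y) (Site.fibreSite 0 k y r) μ + 1) * 2 ≤ (P.sitesPerDir 0 : ℤ) := by
  have hnw := noWrap_centre hk (Site.fibreSite 0 k y r) μ
  rwa [iterBlockOf_fibreSite hk h y r] at hnw

/-- ★ **THE COMB LOOP**: for `T_r := v₀(x_r) = axialT V c x_r`, `c = embIter k y`, and an interior bond `b = (x_r, x_r + e_μ)` of `B(y)`:
`T_r⁻¹·T_{r+e_μ}·V(b)⁻¹ = T_r⁻¹·L_b⁻¹·T_r`, `L_b = V(Γ_{c,x_r} ∪ b ∪ Γ_{x_r+e_μ,c})` (✓ `holT_contourT`). [cite: Balaban1985UV3, (27) p.263; Balaban1985Averaging, (8) p.19] -/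
theorem comb_loop_eq (hk : k ≤ P.m + P.K) (h : P.sitesPerDir 0 = P.L ^ k * P.sitesPerDir k) (V : GaugeField P 0 G) (y : Site P k)
    (r : Fin P.d → Fin (P.L ^ k)) (μ : Fin P.d) (hr : (r μ : ℕ) + 1 < P.L ^ k) :
    (axialT V (embIter k y) (Site.fibreSite 0 k y r))⁻¹
        * axialT V (embIter k y) (Site.fibreSite 0 k y (Function.update r μ ⟨min ((r μ : ℕ) + 1) (P.L ^ k - 1), by have := (r μ).isLt; omega⟩))
        * (V ⟨Site.fibreSite 0 k y r, μ⟩)⁻¹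
      = (axialT V (embIter k y) (Site.fibreSite 0 k y r))⁻¹ * (holT V (embIter k y) (contourT (embIter k y) ⟨Site.fibreSite 0 k y r, μ⟩))⁻¹
          * axialT V (embIter k y) (Site.fibreSite 0 k y r) := by
  have hloop := holT_contourT V (embIter k y) ⟨Site.fibreSite 0 k y r, μ⟩ (noWrap_fibreSite hk h y r μ)
  have htgt : PBond.tgt ⟨Site.fibreSite 0 k y r, μ⟩ = (Site.fibreSite 0 k y r).shift μ := rfl
  rw [fibreSite_succ_eq_shift y r μ hr, hloop, htgt]
  group

/-- ★★ **THE INTERIOR SUMMAND OF THE BLOCK GAUSS LAW IS `(R(L_b⁻¹) − 1)` ON THE TRANSPORTED FIELD** (units of any ring, centre-based comb):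
`R(T_r)(R(T_r⁻¹·T_{r+e_μ}·V(b)⁻¹)B − B) = R(L_b⁻¹)(R(T_r)B) − R(T_r)B`. [cite: Balaban1985UV3, (27) p.263; Balaban1985BackgroundPropagators, (3.5) p.391] -/
theorem int_summand_eq_loop {𝔸 : Type*} [Ring 𝔸] (hk : k ≤ P.m + P.K) (h : P.sitesPerDir 0 = P.L ^ k * P.sitesPerDir k) (V : GaugeField P 0 𝔸ˣ) (y : Site P k)
    (r : Fin P.d → Fin (P.L ^ k)) (μ : Fin P.d) (hr : (r μ : ℕ) + 1 < P.L ^ k) (X : 𝔸) :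
    R (axialT V (embIter k y) (Site.fibreSite 0 k y r))
        (R ((axialT V (embIter k y) (Site.fibreSite 0 k y r))⁻¹
              * axialT V (embIter k y) (Site.fibreSite 0 k y (Function.update r μ ⟨min ((r μ : ℕ) + 1) (P.L ^ k - 1), by have := (r μ).isLt; omega⟩))
              * (V ⟨Site.fibreSite 0 k y r, μ⟩)⁻¹) X - X)
      = R (holT V (embIter k y) (contourT (embIter k y) ⟨Site.fibreSite 0 k y r, μ⟩))⁻¹ (R (axialT V (embIter k y) (Site.fibreSite 0 k y r)) X)
          - R (axialT V (embIter k y) (Site.fibreSite 0 k y r)) X := by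
  rw [comb_loop_eq hk h V y r μ hr, B9Eq39Adjoint.R_sub, ← B9Eq39Adjoint.R_mul, ← B9Eq39Adjoint.R_mul]
  congr 2
  group

end Loop

/-! ## §2 The pairing with the centre value: the axial local model's covariant derivative -/

section Pairing

variable {N : ℕ}

/-- For unitary `u`: `Re tr(mᴴ·(R(u⁻¹)X − X)) = Re tr((R(u)m − m)ᴴ·X)` (trace cyclicity ✓ `B9Eq39Adjoint.trace_R_mul` + `(R(u)m)ᴴ = R(u)mᴴ` ✓ `conjTranspose_R`). [folklore] -/
theorem re_trace_mul_R_inv_sub {u : (Matrix (Fin N) (Fin N) ℂ)ˣ} (hu : (u : Matrix (Fin N) (Fin N) ℂ) ∈ unitary (Matrix (Fin N) (Fin N) ℂ))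
    (m X : Matrix (Fin N) (Fin N) ℂ) :
    ((mᴴ * (R u⁻¹ X - X)).trace).re = (((R u m - m)ᴴ * X).trace).re := by
  have hcyc : (R u mᴴ * X).trace = (mᴴ * R u⁻¹ X).trace :=
    B9Eq39Adjoint.trace_R_mul (Matrix.traceAddMonoidHom (Fin N) ℂ) (fun a b => Matrix.trace_mul_comm a b) u mᴴ X
  rw [Matrix.mul_sub, Matrix.conjTranspose_sub, Matrix.sub_mul, conjTranspose_R hu, Matrix.trace_sub, Matrix.trace_sub, hcyc]

/-- For unitary `t`: `Re tr((R(t)A)ᴴ·R(t)B) = Re tr(Aᴴ·B)` (the HS pairing is transport-invariant). [folklore] -/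
theorem re_trace_R_pair {t : (Matrix (Fin N) (Fin N) ℂ)ˣ} (ht : (t : Matrix (Fin N) (Fin N) ℂ) ∈ unitary (Matrix (Fin N) (Fin N) ℂ))
    (A B : Matrix (Fin N) (Fin N) ℂ) :
    (((R t A)ᴴ * R t B).trace).re = ((Aᴴ * B).trace).re := by
  rw [conjTranspose_R ht, R_mul_R]
  have hcyc : (R t (Aᴴ * B)).trace = (Aᴴ * B).trace :=
    B9Eq39Adjoint.trace_R (Matrix.traceAddMonoidHom (Fin N) ℂ) (fun a b => Matrix.trace_mul_comm a b) t (Aᴴ * B)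
  rw [hcyc]

variable (hk : k ≤ P.m + P.K) (h : P.sitesPerDir 0 = P.L ^ k * P.sitesPerDir k)
  {V : GaugeField P 0 (Matrix (Fin N) (Fin N) ℂ)ˣ} (hV : ∀ b, V b ∈ unitaryUnits (Matrix (Fin N) (Fin N) ℂ))

include hV in
/-- The comb transport `v₀(x) = axialT V c x` of a unitary-valued configuration is unitary. [cite: Balaban1985Averaging, p.24] -/
theorem axialT_mem_unitary (c x : Site P 0) : ((axialT V c x : (Matrix (Fin N) (Fin N) ℂ)ˣ) : Matrix (Fin N) (Fin N) ℂ) ∈ unitary (Matrix (Fin N) (Fin N) ℂ) := by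
  unfold axialT
  rw [← hol_pull_zero]
  exact mem_unitaryUnits.mp (hol_mem_of (V := B10Eq27TorusAxialLog.pull V c) (fun z κ => hV _) 0 _)

include hV in
/-- The loop of (27) of a unitary-valued configuration is unitary (✓ `hol_mem_of` through the pull-back dictionary; no `CStarAlgebra` instance needed).
[cite: Balaban1985UV3, (27) p.263] -/
theorem holT_contourT_mem_unitary' (c : Site P 0) (b : PBond P 0) :
    ((holT V c (contourT c b) : (Matrix (Fin N) (Fin N) ℂ)ˣ) : Matrix (Fin N) (Fin N) ℂ) ∈ unitary (Matrix (Fin N) (Fin N) ℂ) := by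
  rw [← hol_pull_zero]
  exact mem_unitaryUnits.mp (hol_mem_of (V := B10Eq27TorusAxialLog.pull V c) (fun z κ => hV _) 0 _)

include hk h hV in
/-- ★★★ **ONE INTERIOR BOND: THE GAUSS DEFECT PAIRED WITH THE CENTRE VALUE IS `⟨D_VΨ_m, B⟩`.**  For unitary-valued `V`, `c = embIter k y`, `T_r = axialT V c x_r`, the axial local model
`Ψ_m(z) = R(axialT V c z)⁻¹ m` and an interior bond `(x_r, x_r + e_μ)` of `B(y)`:
`Re tr(mᴴ·R(T_r)(R(T_r⁻¹T_{r+e_μ}V(b)⁻¹)X − X)) = Re tr((D_{V,μ}Ψ_m(x_r))ᴴ·X)`. [cite: Balaban1985UV3, (27) p.263; Balaban1985BackgroundPropagators, (3.3) p.390, (3.5) p.391] -/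
theorem re_trace_int_summand_eq_covD_pairing (y : Site P k) (r : Fin P.d → Fin (P.L ^ k)) (μ : Fin P.d) (hr : (r μ : ℕ) + 1 < P.L ^ k)
    (m X : Matrix (Fin N) (Fin N) ℂ) :
    ((mᴴ * (R (axialT V (embIter k y) (Site.fibreSite 0 k y r))
        (R ((axialT V (embIter k y) (Site.fibreSite 0 k y r))⁻¹
              * axialT V (embIter k y) (Site.fibreSite 0 k y (Function.update r μ ⟨min ((r μ : ℕ) + 1) (P.L ^ k - 1), by have := (r μ).isLt; omega⟩))
              * (V ⟨Site.fibreSite 0 k y r, μ⟩)⁻¹) X - X))).trace).re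
      = (((covD (torusT P 0) (fun κ z => V ⟨z, κ⟩) μ (fun z => R (axialT V (embIter k y) z)⁻¹ m) (Site.fibreSite 0 k y r))ᴴ * X).trace).re := by
  set c := embIter k y with hc
  set x := Site.fibreSite 0 k y r with hx
  set T : (Matrix (Fin N) (Fin N) ℂ)ˣ := axialT V c x with hT
  set L : (Matrix (Fin N) (Fin N) ℂ)ˣ := holT V c (contourT c ⟨x, μ⟩) with hL
  have hTu : (T : Matrix (Fin N) (Fin N) ℂ) ∈ unitary (Matrix (Fin N) (Fin N) ℂ) := axialT_mem_unitary hV c x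
  have hLu : (L : Matrix (Fin N) (Fin N) ℂ) ∈ unitary (Matrix (Fin N) (Fin N) ℂ) := holT_contourT_mem_unitary' hV c ⟨x, μ⟩
  -- the summand is `(R(L⁻¹) − 1)(R(T)X)`
  rw [int_summand_eq_loop hk h V y r μ hr X]
  -- move `L` across the trace, then recognise `R(L)m − m = R(T)(D_VΨ_m)(x)`
  rw [re_trace_mul_R_inv_sub hLu]
  have hD := covD_axialModel V c m μ x (noWrap_fibreSite hk h y r μ)
  have hRT : R T (covD (torusT P 0) (fun κ z => V ⟨z, κ⟩) μ (fun z => R (axialT V c z)⁻¹ m) x) = R L m - m := by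
    rw [hD, hT, R_R_inv]
  rw [← hRT, re_trace_R_pair hTu]

include hk h hV in
/-- ★★★ **THE BLOCK: `Re tr(mᴴ·INT(y)) = Σ_μ Σ_{(x_r, x_r+e_μ) ⊂ B(y)} Re tr((D_{V,μ}Ψ_m(x_r))ᴴ·B_μ(x_r))`** — the interior holonomy defect of ✓ `block_sum_R_divB_eq` (transports `T_r = axialT V c x_r`,
background `U_μ(x) = V⟨x,μ⟩`) paired with the centre value is the pairing of `B` with the covariant derivative of the axial local model over the interior bonds of the block.
[cite: Balaban1985UV3, (27) p.263; Balaban1985BackgroundPropagators, (3.3)-(3.5) pp.390-391, (3.8) p.392] -/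
theorem re_trace_int_eq_sum_covD_pairing (y : Site P k) (B : Fin P.d → Site P 0 → Matrix (Fin N) (Fin N) ℂ) (m : Matrix (Fin N) (Fin N) ℂ) :
    ((mᴴ * ∑ μ : Fin P.d, ∑ r ∈ univ.filter (fun r : Fin P.d → Fin (P.L ^ k) => (r μ : ℕ) + 1 < P.L ^ k),
        R (axialT V (embIter k y) (Site.fibreSite 0 k y r))
          (R ((axialT V (embIter k y) (Site.fibreSite 0 k y r))⁻¹
                * axialT V (embIter k y) (Site.fibreSite 0 k y (Function.update r μ ⟨min ((r μ : ℕ) + 1) (P.L ^ k - 1), by have := (r μ).isLt; omega⟩))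
                * (V ⟨Site.fibreSite 0 k y r, μ⟩)⁻¹) (B μ (Site.fibreSite 0 k y r)) - B μ (Site.fibreSite 0 k y r))).trace).re
      = ∑ μ : Fin P.d, ∑ r ∈ univ.filter (fun r : Fin P.d → Fin (P.L ^ k) => (r μ : ℕ) + 1 < P.L ^ k),
          (((covD (torusT P 0) (fun κ z => V ⟨z, κ⟩) μ (fun z => R (axialT V (embIter k y) z)⁻¹ m) (Site.fibreSite 0 k y r))ᴴ
              * B μ (Site.fibreSite 0 k y r)).trace).re := by
  rw [Matrix.mul_sum, Matrix.trace_sum, Complex.re_sum]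
  refine Finset.sum_congr rfl fun μ _ => ?_
  rw [Matrix.mul_sum, Matrix.trace_sum, Complex.re_sum]
  refine Finset.sum_congr rfl fun r hr => ?_
  exact re_trace_int_summand_eq_covD_pairing hk h hV y r μ (Finset.mem_filter.mp hr).2 m _

include hk h hV in
/-- ★★★ **THE COARSE NET FLUX PAIRED WITH THE CENTRE VALUE** (✓ `block_netFlux_eq_int_add_junction` with the centre-based combs of every block, `T_{y′} r = axialT V (embIter k y′) x^{y′}_r`,
coarse bond units `W_μ(y′)` arbitrary, `B` covariantly co-closed):
`Re tr(mᴴ·Σ_μ (OUT_μ(y) − R(W_μ(y−e_μ)⁻¹)OUT_μ(y−e_μ))) = Σ_μ Σ_{int} Re tr((D_{V,μ}Ψ_m(x_r))ᴴ·B_μ(x_r)) + Re tr(mᴴ·J_VH(y))` — interior ⇒ Dirichlet energy of the local model,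
junction displayed. [cite: Balaban1984PropagatorsI, (1.21) p.21; Balaban1985UV3, (27) p.263; Balaban1985BackgroundPropagators, (3.8) p.392] -/
theorem re_trace_netFlux_eq (Wc : Fin P.d → Site P k → (Matrix (Fin N) (Fin N) ℂ)ˣ) (B : Fin P.d → Site P 0 → Matrix (Fin N) (Fin N) ℂ)
    (hB : ∀ x : Site P 0, divB (torusT P 0) (fun κ z => V ⟨z, κ⟩) B x = 0) (y : Site P k) (m : Matrix (Fin N) (Fin N) ℂ) :
    ((mᴴ * ∑ μ : Fin P.d, (∑ r ∈ univ.filter (fun r : Fin P.d → Fin (P.L ^ k) => (r μ : ℕ) + 1 = P.L ^ k),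
          R (axialT V (embIter k y) (Site.fibreSite 0 k y r)) (B μ (Site.fibreSite 0 k y r))
        - R (Wc μ (y.unshift μ))⁻¹ (∑ r ∈ univ.filter (fun r : Fin P.d → Fin (P.L ^ k) => (r μ : ℕ) + 1 = P.L ^ k),
            R (axialT V (embIter k (y.unshift μ)) (Site.fibreSite 0 k (y.unshift μ) r)) (B μ (Site.fibreSite 0 k (y.unshift μ) r))))).trace).re
      = (∑ μ : Fin P.d, ∑ r ∈ univ.filter (fun r : Fin P.d → Fin (P.L ^ k) => (r μ : ℕ) + 1 < P.L ^ k),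
          (((covD (torusT P 0) (fun κ z => V ⟨z, κ⟩) μ (fun z => R (axialT V (embIter k y) z)⁻¹ m) (Site.fibreSite 0 k y r))ᴴ
              * B μ (Site.fibreSite 0 k y r)).trace).re)
        + ((mᴴ * ∑ μ : Fin P.d, ∑ r ∈ univ.filter (fun r : Fin P.d → Fin (P.L ^ k) => (r μ : ℕ) + 1 = P.L ^ k),
            (R (axialT V (embIter k y) (Site.fibreSite 0 k y (Function.update r μ ⟨0, pow_pos P.L_pos k⟩)) * (V ⟨Site.fibreSite 0 k (y.unshift μ) r, μ⟩)⁻¹)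
                (B μ (Site.fibreSite 0 k (y.unshift μ) r))
              - R ((Wc μ (y.unshift μ))⁻¹ * axialT V (embIter k (y.unshift μ)) (Site.fibreSite 0 k (y.unshift μ) r))
                (B μ (Site.fibreSite 0 k (y.unshift μ) r)))).trace).re := by
  rw [block_netFlux_eq_int_add_junction h (fun y' r => axialT V (embIter k y') (Site.fibreSite 0 k y' r)) Wc (fun κ z => V ⟨z, κ⟩) B hB y,
    Matrix.mul_add, Matrix.trace_add, Complex.add_re, re_trace_int_eq_sum_covD_pairing hk h hV y B m]

end Pairing

end Summit.QuantumFields.YangMills.Theorems.Prop7CovBlockGaussIntPairing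

end
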